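import Summits.Ventures.LatticeQCDFlow.Exactness.ReversibleVariationalFloorThinned
import Summits.Ventures.LatticeQCDFlow.Exactness.Phi4PhaseLabelFlipRate
import Summits.Ventures.LatticeQCDFlow.Exactness.Phi4MetropolisSignTunnellingCSD
import Summits.Ventures.LatticeQCDFlow.Exactness.Phi4MetropolisMagnetisationMomentCSD
import HarnessLib

/-!
# The MAGNETISATION ITSELF inherits the tunnelling floors of the local arm: `τ_int,sweep(M) ≥ ⟨|M|⟩²/(2 V Var(M) ⟨r_flip⟩) − ½` and `≥ ⟨|M|⟩²/(V Var(M) π(|M| ≤ δ)) − ½`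

HONEST FRAMING: exact (Metropolis-corrected) sampling algorithms for lattice gauge theory;
figures of merit are autocorrelation/cost numbers at stated couplings and volumes; no
continuum-physics claim.  (SCALAR calibration rung S0-A: not a gauge result.)

Venture `LatticeQCDFlow` (cell pub-lqcd), topic `Exactness`; FANOUT row 2 (`s0-phi4`, the LOCAL
arm: random-site-scan Metropolis `metroScan J λ ρ` of lattice φ⁴, one SWEEP = `V = n+1`
proposals).  NEW WORK of the cell: the lattice instance of the variational floor
(`Exactness/ReversibleVariationalFloorThinned.lean`, `RevOp.thinned_tauInt_ge_variational`) on the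
polynomial class `PolyObs` (`Phi4MetropolisPolyObs*`: the scan is a reversible `L²(e^{−S})`
contraction there for every even step density with all moments), with the PHASE LABEL
`θ = ±1` of `{c ≤ F}` as trial observable, whose Dirichlet form is `2 ∫ r_flip e^{−S}`
(`Phi4PhaseLabelFlipRate.metroScan_labelDev_eq_flip`) and, for `θ = sgn M`, at most the mass of the
strip a proposal can cross (`Phi4MetropolisSignTunnellingCSD.integral_metroScan_signDev_le`,
`reach_le_strip`).  Nothing is cited as a fact.  Printed counterparts NAMED ONLY: the
trial-observable bounds of Caracciolo–Pelissetto–Sokal 1990 (J. Stat. Phys. 60); the exponential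
tunnelling time of local dynamics in the two-phase regime (`τ ∼ e^{2σL^{d−1}}`, Binder 1982;
rigorous for Glauber–Ising: Thomas 1989, Martinelli 1997) — here as a certified floor for the
MAGNETISATION's own `τ_int` priced by MEASURED equilibrium quantities, no mixing hypothesis.

## What is proved (`Λ = Fin (n+1)`, `V = n+1`, every `λ > 0`, every real `J`, `ρ` an even
probability density with all moments `∫(1+|u|)^j ρ < ∞` — the window `U[−δ,δ]` and Gaussian steps
included; `⟨·⟩` the Gibbs mean; `K = metroScan J λ ρ`; hypothesis of every floor, NOT discharged
for any run: the sweep-thinned autocorrelation series of the observable is summable)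

* `metropolisScan_tauInt_sweep_ge_cross_of_carre_le` (raw form, any bound `∫ Γ_θ e^{−S} ≤ D`) and
  **`metropolisScan_tauInt_sweep_ge_cross`** — CROSS-OBSERVABLE FLOOR: for every `g ∈ PolyObs`
  (e.g. `M − ⟨M⟩`, `S − ⟨S⟩`, any bounded measurable observable) and every phase label `θ` of a
  measurable `F` at level `c`, with `r(φ) = K[χ_flip(·, φ)](φ)` the probability that the next
  proposal is accepted AND changes the label:
  **`τ_int,sweep(g) ≥ ⟨g θ⟩² / (⟨g²⟩ · 2V⟨r⟩) − ½`**.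
  (For centred `g`: `⟨gθ⟩ = Cov(g, θ)`; with gen-16's label floor this reads
  `τ_int,sweep(g) + ½ ≥ Corr(g, θ)² · (Var(θ)/(2V⟨r⟩))`.)
* **`metropolisScan_tauInt_sweep_ge_magnetisation_signFlip`** — `g = M − ⟨M⟩`, `θ = sgn M`
  (`⟨sgn M⟩ = 0` by `Z₂`, `M · sgn M = |M|`):
  **`τ_int,sweep(M) ≥ ⟨|M|⟩² / (2 V Var(M) ⟨r_sign⟩) − ½`**, `V⟨r_sign⟩` = mean number of accepted
  sign changes of `M` per sweep.
* **`metropolisScan_tauInt_sweep_ge_magnetisation_reach`** — every even step density: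
  `τ_int,sweep(M) ≥ ⟨|M|⟩² / (V Var(M) ⟨P_ρ(|u| ≥ |M|)⟩) − ½`;
  **`metropolisScan_tauInt_sweep_ge_magnetisation_strip`** — window-supported `ρ` (`ρ = 0` off
  `[−δ, δ]`): **`τ_int,sweep(M) ≥ ⟨|M|⟩² / (V · Var(M) · π(|M| ≤ δ)) − ½`**.

Reading (no numerics implied): in the two-peak regime `⟨|M|⟩² ≈ ⟨M²⟩ = Var(M)` and the
magnetisation's own integrated autocorrelation time per sweep is at least the inverse equilibrium
mass of the strip `|M| ≤ δ` (the valley of the histogram, `∝ e^{−ΔF}`) over `V`, and at least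
`1/(2 · sign flips per sweep)`: gen-16's floors for the artificial label `sgn M` now hold for the
measured observable `M`.  In the symmetric phase `⟨|M|⟩²/Var(M) → 2/π` (Gaussian) and the strip
mass is not small: the floor is weak there, correctly.  NOT CLAIMED: summability for any run; any
value of `⟨r⟩`, `π(|M| ≤ δ)`, `⟨|M|⟩` for a run; the ordered sweep; upper bounds; `Z₂`-even
observables (`|M|`, `M²`, `S`: `⟨g · sgn M⟩ = 0`, no transfer — they CAN be fast while `sgn M` is
frozen).
-/

namespace Summit.Ventures.LatticeQCDFlow.Exactness

open Real MeasureTheory Filter Finset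
open Summit.Ventures.LatticeQCDFlow.Scoring

section MagnetisationTunnelling

variable {n : ℕ}

/-- Bookkeeping: `(I/Z)²/((P/Z)(c(R/Z))) = I²/(P(cR))` (`Z ≠ 0`). -/
theorem cross_floor_transfer {Z : ℝ} (hZ : Z ≠ 0) (I P R c : ℝ) :
    (I / Z) ^ 2 / (P / Z * (c * (R / Z))) = I ^ 2 / (P * (c * R)) := by
  have e1 : (I / Z) ^ 2 = I ^ 2 / Z ^ 2 := by rw [div_pow]
  have e2 : P / Z * (c * (R / Z)) = P * (c * R) / Z ^ 2 := by
    field_simp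
  rw [e1, e2, div_div_div_cancel_right₀ (pow_ne_zero 2 hZ)]

/-- `M · sgn M = |M|` with the convention `sgn 0 = 1`. -/
theorem mul_sign_eq_abs (s : ℝ) : s * (if 0 ≤ s then (1 : ℝ) else -1) = |s| := by
  split_ifs with h
  · rw [mul_one, abs_of_nonneg h]
  · rw [abs_of_neg (lt_of_not_ge h)]; ring

/-- **THE CROSS-OBSERVABLE FLOOR OF THE LOCAL ARM (raw form).**  `g ∈ PolyObs`, `θ` the label of a
measurable `F` at level `c`; if `∫ K[(θ − θ φ)²](φ) e^{−S} ≤ D` and the sweep-thinned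
autocorrelation series of `g` is summable, then
`τ_int,sweep(g) ≥ (∫ g θ e^{−S})² / (∫ g² e^{−S} · (n+1) · D/2) − ½`. -/
theorem metropolisScan_tauInt_sweep_ge_cross_of_carre_le {lam : ℝ} (hlam : 0 < lam)
    (J : Fin (n + 1) → Fin (n + 1) → ℝ) {ρ : ℝ → ℝ} (hρ0 : ∀ u, 0 ≤ ρ u) (hρm : Measurable ρ)
    (hρi : Integrable ρ) (hρ1 : ∫ u, ρ u = 1) (hρs : ∀ u, ρ (-u) = ρ u)
    (hρmom : ∀ j : ℕ, Integrable (fun u => (1 + |u|) ^ j * ρ u))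
    {g : (Fin (n + 1) → ℝ) → ℝ} (hg : PolyObs g)
    {F : (Fin (n + 1) → ℝ) → ℝ} (hF : Measurable F) (c : ℝ) {D : ℝ}
    (hΓ : ∫ φ, metroScan J lam ρ (fun ψ => ((if c ≤ F ψ then (1 : ℝ) else -1)
        - (if c ≤ F φ then (1 : ℝ) else -1)) ^ 2) φ * gibbsWeight J lam φ ≤ D)
    (hs : Summable fun k => (∫ φ, g φ * ((metroScan J lam ρ)^[(n + 1) * (k + 1)] g) φ
        * gibbsWeight J lam φ) / ∫ φ, g φ ^ 2 * gibbsWeight J lam φ) :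
    (∫ φ, g φ * (if c ≤ F φ then (1 : ℝ) else -1) * gibbsWeight J lam φ) ^ 2
        / ((∫ φ, g φ ^ 2 * gibbsWeight J lam φ) * ((n + 1 : ℕ) * (D / 2))) - 1 / 2
      ≤ tauInt (fun k => (∫ φ, g φ * ((metroScan J lam ρ)^[(n + 1) * k] g) φ
        * gibbsWeight J lam φ) / ∫ φ, g φ ^ 2 * gibbsWeight J lam φ) := by
  have hco := latticePhi4Action_coercive hlam J
  have hθ : PolyObs (fun φ : Fin (n + 1) → ℝ => if c ≤ F φ then (1 : ℝ) else -1) :=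
    polyObs_of_bddObs (label_bddObs hF c)
  have hθ2 := polyObs_sq hθ
  have hE := RevOp.dirichlet_le_of_integral_carre_le (μ := volume) (A := PolyObs)
    (K := metroScan J lam ρ) (w := gibbsWeight J lam) (polyObs_const 1)
    (fun f h hf hh => polyObs_integrable_mul_mul_gibbsWeight one_pos hco hf hh)
    (fun f h c hf hh => polyObs_add_mul hf hh c)
    (fun f hf => polyObs_metroScan J lam hρ0 hρm hρmom hf)
    (fun f h c hf hh x => metroScan_add_mul_poly J lam hρ0 hρm hρmom hf hh c x)
    (fun f h hf hh => metroScan_reversible_poly one_pos hco hρ0 hρm hρi hρ1 hρs hρmom hf hh)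
    (fun φ => metroScan_one J lam hρ1 φ) hθ hθ2 hΓ
  exact RevOp.thinned_tauInt_ge_variational (μ := volume) (A := PolyObs)
    (K := metroScan J lam ρ) (w := gibbsWeight J lam)
    (fun φ => (gibbsWeight_pos J lam φ).le)
    (fun f h hf hh => polyObs_integrable_mul_mul_gibbsWeight one_pos hco hf hh)
    (fun f h c hf hh => polyObs_add_mul hf hh c)
    (fun f hf => polyObs_metroScan J lam hρ0 hρm hρmom hf)
    (fun f h c hf hh x => metroScan_add_mul_poly J lam hρ0 hρm hρmom hf hh c x)
    (fun f h hf hh => metroScan_reversible_poly one_pos hco hρ0 hρm hρi hρ1 hρs hρmom hf hh)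
    (fun f hf => metroScan_contraction_poly one_pos hco hρ0 hρm hρi hρ1 hρs hρmom hf)
    hg hθ (n + 1) hs hE

/-- **THE CROSS-OBSERVABLE FLOOR OF THE LOCAL ARM.**  Lattice φ⁴ (`λ > 0`, real `J`), `ρ` an even
probability density with all moments, `K` the random-site-scan Metropolis operator, one sweep =
`n+1` proposals; `g ∈ PolyObs` any polynomial-envelope observable; `F` measurable, `c` a level,
`θ = ±1` the label of `{c ≤ F}`, `r(φ) = K[χ_flip(·, φ)](φ)`.  If the sweep-thinned
autocorrelation series of `g` is summable, then
`τ_int,sweep(g) ≥ ⟨g θ⟩² / (⟨g²⟩ · 2 (n+1) ⟨r⟩) − ½`. -/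
theorem metropolisScan_tauInt_sweep_ge_cross {lam : ℝ} (hlam : 0 < lam)
    (J : Fin (n + 1) → Fin (n + 1) → ℝ) {ρ : ℝ → ℝ} (hρ0 : ∀ u, 0 ≤ ρ u) (hρm : Measurable ρ)
    (hρi : Integrable ρ) (hρ1 : ∫ u, ρ u = 1) (hρs : ∀ u, ρ (-u) = ρ u)
    (hρmom : ∀ j : ℕ, Integrable (fun u => (1 + |u|) ^ j * ρ u))
    {g : (Fin (n + 1) → ℝ) → ℝ} (hg : PolyObs g)
    {F : (Fin (n + 1) → ℝ) → ℝ} (hF : Measurable F) (c : ℝ)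
    (hs : Summable fun k => (∫ φ, g φ * ((metroScan J lam ρ)^[(n + 1) * (k + 1)] g) φ
        * gibbsWeight J lam φ) / ∫ φ, g φ ^ 2 * gibbsWeight J lam φ) :
    gibbsExpect J lam (fun φ => g φ * (if c ≤ F φ then (1 : ℝ) else -1)) ^ 2
        / (gibbsExpect J lam (fun φ => g φ ^ 2) * (2 * ((n : ℝ) + 1)
          * gibbsExpect J lam (fun φ =>
            metroScan J lam ρ (fun ψ => if (c ≤ F ψ ↔ c ≤ F φ) then (0 : ℝ) else 1) φ))) - 1 / 2
      ≤ tauInt (fun k => (∫ φ, g φ * ((metroScan J lam ρ)^[(n + 1) * k] g) φ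
        * gibbsWeight J lam φ) / ∫ φ, g φ ^ 2 * gibbsWeight J lam φ) := by
  -- the integrated carré du champ of the label is `4 ∫ r e^{−S}`
  have hΓ : ∫ φ, metroScan J lam ρ (fun ψ => ((if c ≤ F ψ then (1 : ℝ) else -1)
        - (if c ≤ F φ then (1 : ℝ) else -1)) ^ 2) φ * gibbsWeight J lam φ
      ≤ 4 * ∫ φ, metroScan J lam ρ (fun ψ => if (c ≤ F ψ ↔ c ≤ F φ) then (0 : ℝ) else 1) φ
        * gibbsWeight J lam φ := by
    refine le_of_eq ?_
    rw [← integral_const_mul]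
    refine integral_congr_ae (Eventually.of_forall fun φ => ?_)
    show metroScan J lam ρ (fun ψ => ((if c ≤ F ψ then (1 : ℝ) else -1)
        - (if c ≤ F φ then (1 : ℝ) else -1)) ^ 2) φ * gibbsWeight J lam φ
      = 4 * (metroScan J lam ρ (fun ψ => if (c ≤ F ψ ↔ c ≤ F φ) then (0 : ℝ) else 1) φ
        * gibbsWeight J lam φ)
    have h := metroScan_labelDev_eq_flip J lam ρ F c 0 φ
    simp only [sub_zero] at h
    rw [h, mul_assoc]
  have hfloor := metropolisScan_tauInt_sweep_ge_cross_of_carre_le hlam J hρ0 hρm hρi hρ1 hρs hρmom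
    hg hF c hΓ hs
  have hZ : gibbsZ J lam ≠ 0 := (gibbsZ_pos hlam J).ne'
  unfold gibbsExpect
  rw [cross_floor_transfer hZ]
  have e : ∀ P R : ℝ, P * (((n + 1 : ℕ) : ℝ) * (4 * R / 2)) = P * (2 * ((n : ℝ) + 1) * R) := by
    intro P R; push_cast; ring
  rw [← e]
  exact hfloor

/-- `∫ (M − m) sgn M e^{−S} = ∫ |M| e^{−S}`: `M sgn M = |M|` and `∫ sgn M e^{−S} = 0` (`Z₂`). -/
theorem integral_magnetisation_sub_mul_sign {lam : ℝ} (hlam : 0 < lam)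
    (J : Fin (n + 1) → Fin (n + 1) → ℝ) (m : ℝ) :
    ∫ φ : Fin (n + 1) → ℝ, ((∑ y, φ y) - m) * (if 0 ≤ ∑ y, φ y then (1 : ℝ) else -1)
        * gibbsWeight J lam φ
      = ∫ φ : Fin (n + 1) → ℝ, |∑ y, φ y| * gibbsWeight J lam φ := by
  have hco := latticePhi4Action_coercive hlam J
  have hMm : Measurable fun φ : Fin (n + 1) → ℝ => ∑ y, φ y :=
    Finset.measurable_sum _ fun y _ => measurable_pi_apply y
  have hθ : PolyObs (fun φ : Fin (n + 1) → ℝ => if 0 ≤ ∑ y, φ y then (1 : ℝ) else -1) :=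
    polyObs_of_bddObs (label_bddObs hMm 0)
  have iMθ : Integrable (fun φ : Fin (n + 1) → ℝ =>
      (∑ y, φ y) * (if 0 ≤ ∑ y, φ y then (1 : ℝ) else -1) * gibbsWeight J lam φ) :=
    polyObs_integrable_mul_mul_gibbsWeight one_pos hco polyObs_magnetisation hθ
  have iθ : Integrable (fun φ : Fin (n + 1) → ℝ =>
      (if 0 ≤ ∑ y, φ y then (1 : ℝ) else -1) * gibbsWeight J lam φ) := by
    have h := polyObs_integrable_mul_mul_gibbsWeight one_pos hco hθ (polyObs_const 1)
    exact h.congr (Eventually.of_forall fun φ => by simp only [mul_one])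
  have h0 := integral_signM_mul_gibbsWeight J lam (n := n)
  have e : ∀ φ : Fin (n + 1) → ℝ,
      ((∑ y, φ y) - m) * (if 0 ≤ ∑ y, φ y then (1 : ℝ) else -1) * gibbsWeight J lam φ
        = (∑ y, φ y) * (if 0 ≤ ∑ y, φ y then (1 : ℝ) else -1) * gibbsWeight J lam φ
          - m * ((if 0 ≤ ∑ y, φ y then (1 : ℝ) else -1) * gibbsWeight J lam φ) := fun φ => by ring
  simp_rw [e]
  rw [integral_sub iMθ (iθ.const_mul m), integral_const_mul, h0, mul_zero, sub_zero]
  refine integral_congr_ae (Eventually.of_forall fun φ => ?_)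
  show (∑ y, φ y) * (if 0 ≤ ∑ y, φ y then (1 : ℝ) else -1) * gibbsWeight J lam φ
    = |∑ y, φ y| * gibbsWeight J lam φ
  rw [mul_sign_eq_abs]

/-- Normalised: `⟨(M − m) sgn M⟩ = ⟨|M|⟩`. -/
theorem gibbsExpect_magnetisation_sub_mul_sign {lam : ℝ} (hlam : 0 < lam)
    (J : Fin (n + 1) → Fin (n + 1) → ℝ) (m : ℝ) :
    gibbsExpect J lam (fun φ => ((∑ y, φ y) - m) * (if 0 ≤ ∑ y, φ y then (1 : ℝ) else -1))
      = gibbsExpect J lam (fun φ => |∑ y, φ y|) := by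
  unfold gibbsExpect
  rw [integral_magnetisation_sub_mul_sign hlam J m]

/-- **THE MAGNETISATION INHERITS THE SIGN-FLIP FLOOR.**  `g = M − ⟨M⟩`, `θ = sgn M`,
`r_sign(φ) = K[χ_sign flip(·, φ)](φ)`; if the sweep-thinned autocorrelation series of `M` is summable:
`τ_int,sweep(M) ≥ ⟨|M|⟩² / (Var(M) · 2 (n+1) ⟨r_sign⟩) − ½`
(`(n+1)⟨r_sign⟩` = equilibrium mean number of accepted sign changes of `M` per sweep). -/
theorem metropolisScan_tauInt_sweep_ge_magnetisation_signFlip {lam : ℝ} (hlam : 0 < lam)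
    (J : Fin (n + 1) → Fin (n + 1) → ℝ) {ρ : ℝ → ℝ} (hρ0 : ∀ u, 0 ≤ ρ u) (hρm : Measurable ρ)
    (hρi : Integrable ρ) (hρ1 : ∫ u, ρ u = 1) (hρs : ∀ u, ρ (-u) = ρ u)
    (hρmom : ∀ j : ℕ, Integrable (fun u => (1 + |u|) ^ j * ρ u))
    (hs : Summable fun k => (∫ φ, ((∑ y, φ y) - gibbsExpect J lam (fun ψ => ∑ y, ψ y))
        * ((metroScan J lam ρ)^[(n + 1) * (k + 1)]
            (fun ψ => (∑ y, ψ y) - gibbsExpect J lam (fun ψ => ∑ y, ψ y))) φ * gibbsWeight J lam φ)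
        / ∫ φ, ((∑ y, φ y) - gibbsExpect J lam (fun ψ => ∑ y, ψ y)) ^ 2 * gibbsWeight J lam φ) :
    gibbsExpect J lam (fun φ => |∑ y, φ y|) ^ 2
        / (gibbsExpect J lam (fun φ => ((∑ y, φ y) - gibbsExpect J lam (fun ψ => ∑ y, ψ y)) ^ 2)
          * (2 * ((n : ℝ) + 1) * gibbsExpect J lam (fun φ =>
            metroScan J lam ρ (fun ψ => if (0 ≤ ∑ y, ψ y ↔ 0 ≤ ∑ y, φ y) then (0 : ℝ) else 1) φ)))
        - 1 / 2
      ≤ tauInt (fun k => (∫ φ, ((∑ y, φ y) - gibbsExpect J lam (fun ψ => ∑ y, ψ y))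
        * ((metroScan J lam ρ)^[(n + 1) * k]
            (fun ψ => (∑ y, ψ y) - gibbsExpect J lam (fun ψ => ∑ y, ψ y))) φ * gibbsWeight J lam φ)
        / ∫ φ, ((∑ y, φ y) - gibbsExpect J lam (fun ψ => ∑ y, ψ y)) ^ 2 * gibbsWeight J lam φ) := by
  have hMm : Measurable fun φ : Fin (n + 1) → ℝ => ∑ y, φ y :=
    Finset.measurable_sum _ fun y _ => measurable_pi_apply y
  set m := gibbsExpect J lam (fun ψ : Fin (n + 1) → ℝ => ∑ y, ψ y) with hm
  have h := metropolisScan_tauInt_sweep_ge_cross hlam J hρ0 hρm hρi hρ1 hρs hρmom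
    (polyObs_magnetisation_sub m) hMm 0 hs
  rw [gibbsExpect_magnetisation_sub_mul_sign hlam J m] at h
  exact h

/-- **THE MAGNETISATION INHERITS THE `Z₂` TUNNELLING FLOOR (every even step density).**
`τ_int,sweep(M) ≥ ⟨|M|⟩² / (Var(M) · (n+1) ⟨P_ρ(|u| ≥ |M|)⟩) − ½`, `⟨P_ρ(|u| ≥ |M|)⟩` the
equilibrium probability that a proposed increment is long enough to reach `M = 0`. -/
theorem metropolisScan_tauInt_sweep_ge_magnetisation_reach {lam : ℝ} (hlam : 0 < lam)
    (J : Fin (n + 1) → Fin (n + 1) → ℝ) {ρ : ℝ → ℝ} (hρ0 : ∀ u, 0 ≤ ρ u) (hρm : Measurable ρ)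
    (hρi : Integrable ρ) (hρ1 : ∫ u, ρ u = 1) (hρs : ∀ u, ρ (-u) = ρ u)
    (hρmom : ∀ j : ℕ, Integrable (fun u => (1 + |u|) ^ j * ρ u))
    (hs : Summable fun k => (∫ φ, ((∑ y, φ y) - gibbsExpect J lam (fun ψ => ∑ y, ψ y))
        * ((metroScan J lam ρ)^[(n + 1) * (k + 1)]
            (fun ψ => (∑ y, ψ y) - gibbsExpect J lam (fun ψ => ∑ y, ψ y))) φ * gibbsWeight J lam φ)
        / ∫ φ, ((∑ y, φ y) - gibbsExpect J lam (fun ψ => ∑ y, ψ y)) ^ 2 * gibbsWeight J lam φ) :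
    gibbsExpect J lam (fun φ => |∑ y, φ y|) ^ 2
        / (gibbsExpect J lam (fun φ => ((∑ y, φ y) - gibbsExpect J lam (fun ψ => ∑ y, ψ y)) ^ 2)
          * (((n : ℝ) + 1) * gibbsExpect J lam (fun φ =>
            ∫ u, (if |(∑ y, φ y) - 0| ≤ 1 * |u| then ρ u else 0))))
        - 1 / 2
      ≤ tauInt (fun k => (∫ φ, ((∑ y, φ y) - gibbsExpect J lam (fun ψ => ∑ y, ψ y))
        * ((metroScan J lam ρ)^[(n + 1) * k]
            (fun ψ => (∑ y, ψ y) - gibbsExpect J lam (fun ψ => ∑ y, ψ y))) φ * gibbsWeight J lam φ)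
        / ∫ φ, ((∑ y, φ y) - gibbsExpect J lam (fun ψ => ∑ y, ψ y)) ^ 2 * gibbsWeight J lam φ) := by
  have hMm : Measurable fun φ : Fin (n + 1) → ℝ => ∑ y, φ y :=
    Finset.measurable_sum _ fun y _ => measurable_pi_apply y
  set m := gibbsExpect J lam (fun ψ : Fin (n + 1) → ℝ => ∑ y, ψ y) with hm
  have hΓ := integral_metroScan_signDev_le hlam J hρ0 hρm hρi hρ1 hρs
  have hfloor := metropolisScan_tauInt_sweep_ge_cross_of_carre_le hlam J hρ0 hρm hρi hρ1 hρs hρmom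
    (polyObs_magnetisation_sub m) hMm 0 hΓ hs
  rw [integral_magnetisation_sub_mul_sign hlam J m] at hfloor
  have hZ : gibbsZ J lam ≠ 0 := (gibbsZ_pos hlam J).ne'
  unfold gibbsExpect
  rw [cross_floor_transfer hZ]
  have e : ∀ P R : ℝ, P * (((n + 1 : ℕ) : ℝ) * (2 * R / 2)) = P * (((n : ℝ) + 1) * R) := by
    intro P R; push_cast; ring
  rw [← e]
  exact hfloor

/-- **THE MAGNETISATION INHERITS THE `Z₂` TUNNELLING FLOOR (window step law).**  For a step density
vanishing outside `[−δ, δ]`:  `τ_int,sweep(M) ≥ ⟨|M|⟩² / (Var(M) · (n+1) · π(|M| ≤ δ)) − ½`,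
`π(|M| ≤ δ) = ⟨1{|M| ≤ δ}⟩` the equilibrium mass of the strip around `M = 0` — the bottom of the
valley of the magnetisation histogram in the two-peak regime. -/
theorem metropolisScan_tauInt_sweep_ge_magnetisation_strip {lam : ℝ} (hlam : 0 < lam)
    (J : Fin (n + 1) → Fin (n + 1) → ℝ) {ρ : ℝ → ℝ} (hρ0 : ∀ u, 0 ≤ ρ u) (hρm : Measurable ρ)
    (hρi : Integrable ρ) (hρ1 : ∫ u, ρ u = 1) (hρs : ∀ u, ρ (-u) = ρ u) {δ : ℝ}
    (hρδ : ∀ u, δ < |u| → ρ u = 0)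
    (hs : Summable fun k => (∫ φ, ((∑ y, φ y) - gibbsExpect J lam (fun ψ => ∑ y, ψ y))
        * ((metroScan J lam ρ)^[(n + 1) * (k + 1)]
            (fun ψ => (∑ y, ψ y) - gibbsExpect J lam (fun ψ => ∑ y, ψ y))) φ * gibbsWeight J lam φ)
        / ∫ φ, ((∑ y, φ y) - gibbsExpect J lam (fun ψ => ∑ y, ψ y)) ^ 2 * gibbsWeight J lam φ) :
    gibbsExpect J lam (fun φ => |∑ y, φ y|) ^ 2
        / (gibbsExpect J lam (fun φ => ((∑ y, φ y) - gibbsExpect J lam (fun ψ => ∑ y, ψ y)) ^ 2)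
          * (((n : ℝ) + 1) * gibbsExpect J lam (fun φ => if |∑ y, φ y| ≤ δ then (1 : ℝ) else 0)))
        - 1 / 2
      ≤ tauInt (fun k => (∫ φ, ((∑ y, φ y) - gibbsExpect J lam (fun ψ => ∑ y, ψ y))
        * ((metroScan J lam ρ)^[(n + 1) * k]
            (fun ψ => (∑ y, ψ y) - gibbsExpect J lam (fun ψ => ∑ y, ψ y))) φ * gibbsWeight J lam φ)
        / ∫ φ, ((∑ y, φ y) - gibbsExpect J lam (fun ψ => ∑ y, ψ y)) ^ 2 * gibbsWeight J lam φ) := by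
  have hmom := window_moments hρ0 hρm hρi hρδ
  have hw := integrable_gibbsWeight hlam J
  have hMm : Measurable fun φ : Fin (n + 1) → ℝ => ∑ y, φ y :=
    Finset.measurable_sum _ fun y _ => measurable_pi_apply y
  set m := gibbsExpect J lam (fun ψ : Fin (n + 1) → ℝ => ∑ y, ψ y) with hm
  -- the reach probability is dominated by the strip indicator
  have hSm : Measurable (fun φ : Fin (n + 1) → ℝ => if |∑ y, φ y| ≤ δ then (1 : ℝ) else 0) :=
    Measurable.ite (measurableSet_le hMm.abs measurable_const) measurable_const measurable_const
  have hSb : ∀ φ : Fin (n + 1) → ℝ, |(if |∑ y, φ y| ≤ δ then (1 : ℝ) else 0)| ≤ 1 := fun φ => by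
    split_ifs <;> norm_num
  have hSi : Integrable (fun φ : Fin (n + 1) → ℝ =>
      (if |∑ y, φ y| ≤ δ then (1 : ℝ) else 0) * gibbsWeight J lam φ) :=
    integrable_bdd_mul_weight (μ := volume) hSm hSb (continuous_gibbsWeight J lam).measurable
      (fun φ => (gibbsWeight_pos J lam φ).le) hw
  have hΓ : ∫ φ, metroScan J lam ρ (fun ψ => ((if 0 ≤ ∑ y, ψ y then (1 : ℝ) else -1)
        - (if 0 ≤ ∑ y, φ y then (1 : ℝ) else -1)) ^ 2) φ * gibbsWeight J lam φ
      ≤ 2 * ∫ φ, (if |∑ y, φ y| ≤ δ then (1 : ℝ) else 0) * gibbsWeight J lam φ := by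
    refine (integral_metroScan_signDev_le hlam J hρ0 hρm hρi hρ1 hρs).trans ?_
    refine mul_le_mul_of_nonneg_left ?_ (by norm_num)
    refine integral_mono_of_nonneg (Eventually.of_forall fun φ =>
      mul_nonneg (reach_mem_Icc hρ0 hρi hρ1 (fun φ : Fin (n + 1) → ℝ => ∑ y, φ y) 0 1 φ).1
        (gibbsWeight_pos J lam φ).le) hSi (Eventually.of_forall fun φ => ?_)
    have hr := reach_le_strip hρ0 hρi hρ1 hρδ zero_le_one (fun φ : Fin (n + 1) → ℝ => ∑ y, φ y) 0 φ
    have e : (if |(∑ y, φ y) - 0| ≤ 1 * δ then (1 : ℝ) else 0)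
        = (if |∑ y, φ y| ≤ δ then (1 : ℝ) else 0) := by rw [sub_zero, one_mul]
    rw [e] at hr
    exact mul_le_mul_of_nonneg_right hr (gibbsWeight_pos J lam φ).le
  have hfloor := metropolisScan_tauInt_sweep_ge_cross_of_carre_le hlam J hρ0 hρm hρi hρ1 hρs hmom
    (polyObs_magnetisation_sub m) hMm 0 hΓ hs
  rw [integral_magnetisation_sub_mul_sign hlam J m] at hfloor
  have hZ : gibbsZ J lam ≠ 0 := (gibbsZ_pos hlam J).ne'
  unfold gibbsExpect
  rw [cross_floor_transfer hZ]
  have e : ∀ P R : ℝ, P * (((n + 1 : ℕ) : ℝ) * (2 * R / 2)) = P * (((n : ℝ) + 1) * R) := by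
    intro P R; push_cast; ring
  rw [← e]
  exact hfloor

end MagnetisationTunnelling

end Summit.Ventures.LatticeQCDFlow.Exactness
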